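import Mathlib
import Literature.MathematicalPhysics.StatisticalMechanics.LennardJonesClusters
import Summits.AtomisticToContinuum.Crystallization.Theses.BrittleRungDescent

/-!
# `RungAssembly`
(route `BrittleRungDescent`, item `stmt-AtomisticToContinuum-10947`)

Bookkeeping glue for the brittle rung:
`SoftLocalHales → LadderGroundStates → MieSoftKissing → BrittleBarlowRigidity → MieRung`.

Proof. `SoftLocalHales` gives `η₀ > 0`; `BrittleBarlowRigidity` gives `η₁ ∈ (0, 1/100]` and `p₁`;
put `η := min η₀ η₁`; `MieSoftKissing` at `η` gives `p₀`; `LadderGroundStates` gives `q₁` (existence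
of ground states and the separation `1 - 2/q`). For `q ≥ max (max p₀ p₁) (max q₁ 4)` and a
ground-state sequence `x` of `V_q`:
* ground states are `1/2`-separated (`1 - 2/q ≥ 1/2`), hence injective, and a `7`-ball holds at
  most `29³` particles (`card_le_of_separated_of_dist_le`);
* below the gap `63/50` the dichotomy `dist ≤ 1 + η ∨ 63/50 ≤ dist` makes the soft neighbour sets
  at tolerances `η ≤ η₁ < 13/50` coincide, so `η`-kissed atoms are `η₁`-kissed and soft contact
  graphs transport (`kissed_mono`, `shell_transfer`);
* an atom all of whose `7`-neighbours are `η`-kissed has a `4`-ball of `η₁`-kissed atoms with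
  fcc/hcp shell graphs, the graphs supplied by `SoftLocalHales` applied to `S = range (x N)`
  (`good_ball_of_kissed_ball`);
* hence `#bad ≤ 29³ · #(non-η-kissed) = o(N)` (`card_bad_ball_le`), and `BrittleBarlowRigidity`
  applies.
-/

namespace Summit.AtomisticToContinuum.Crystallization.Theorems

open Summit.AtomisticToContinuum.Crystallization.Theses.BrittleRungDescent
open Filter Topology

namespace BrittleRungDescentRungAssembly

/-- Squeeze: if `a N / N → 0`, `0 ≤ b N ≤ C · a N`, then `b N / N → 0`. -/
theorem tendsto_div_natCast_of_le_mul {a b : ℕ → ℝ} {C : ℝ}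
    (ha : Tendsto (fun N : ℕ => a N / N) atTop (𝓝 0))
    (hb0 : ∀ N, 0 ≤ b N) (hb : ∀ N, b N ≤ C * a N) :
    Tendsto (fun N : ℕ => b N / N) atTop (𝓝 0) := by
  have h1 : Tendsto (fun N : ℕ => C * (a N / N)) atTop (𝓝 0) := by
    simpa using ha.const_mul C
  refine tendsto_of_tendsto_of_tendsto_of_le_of_le tendsto_const_nhds h1 (fun N => ?_) (fun N => ?_)
  · exact div_nonneg (hb0 N) (Nat.cast_nonneg N)
  · calc b N / N ≤ C * a N / N := div_le_div_of_nonneg_right (hb N) (Nat.cast_nonneg N)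
      _ = C * (a N / N) := mul_div_assoc C (a N) N

/-- Monotonicity of `Nat.card` of subtypes of `Fin N` along an implication. -/
theorem natCard_subtype_le_of_imp {N : ℕ} {p q : Fin N → Prop} (h : ∀ i, p i → q i) :
    Nat.card {i : Fin N // p i} ≤ Nat.card {i : Fin N // q i} := by
  refine Nat.card_le_card_of_injective (fun a => (⟨a.1, h _ a.2⟩ : {i : Fin N // q i})) ?_
  intro a b hab
  simp only [Subtype.mk.injEq] at hab
  exact Subtype.ext hab

/-- Packing: in a `1/2`-separated configuration of `ℝ³`, at most `29³` particles lie within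
distance `7` of a given one (`card_le_of_separated_of_dist_le`). -/
theorem card_filter_dist_le_seven_le {N : ℕ} (x : Fin N → EuclideanSpace ℝ (Fin 3))
    (hsep : ∀ i j : Fin N, i ≠ j → (1 / 2 : ℝ) ≤ dist (x i) (x j)) (j : Fin N) :
    ((Finset.univ.filter fun i : Fin N => dist (x i) (x j) ≤ 7).card : ℝ) ≤ 29 ^ 3 := by
  classical
  have hinj : Function.Injective x := fun i i' h => by
    by_contra hne
    have := hsep i i' hne
    rw [h, dist_self] at this
    norm_num at this
  have h := Literature.MathematicalPhysics.StatisticalMechanics.card_le_of_separated_of_dist_le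
    ((Finset.univ.filter fun i : Fin N => dist (x i) (x j) ≤ 7).image x) (x j)
    (r := 1 / 2) (R := 7) (by norm_num) (by norm_num) ?_ ?_
  · rw [Finset.card_image_of_injective _ hinj, finrank_euclideanSpace_fin] at h
    norm_num at h ⊢
    exact h
  · intro c hc
    obtain ⟨i, hi, rfl⟩ := Finset.mem_image.1 hc
    exact (Finset.mem_filter.1 hi).2
  · intro c hc d hd hcd
    obtain ⟨i, -, rfl⟩ := Finset.mem_image.1 hc
    obtain ⟨i', -, rfl⟩ := Finset.mem_image.1 hd
    exact hsep i i' fun h => hcd (h ▸ rfl)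

/-- Counting: the atoms whose `7`-ball contains an atom failing `K` number at most
`29³ · #{atoms failing K}` in a `1/2`-separated configuration. -/
theorem card_not_forall_ball_le {N : ℕ} (x : Fin N → EuclideanSpace ℝ (Fin 3))
    (hsep : ∀ i j : Fin N, i ≠ j → (1 / 2 : ℝ) ≤ dist (x i) (x j)) (K : Fin N → Prop) :
    (Nat.card {i : Fin N // ¬ ∀ j : Fin N, dist (x i) (x j) ≤ 7 → K j} : ℝ) ≤
      29 ^ 3 * Nat.card {i : Fin N // ¬ K i} := by
  classical
  set B := Finset.univ.filter fun j : Fin N => ¬ K j with hB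
  have hB' : Nat.card {i : Fin N // ¬ K i} = B.card := by
    rw [Nat.card_eq_fintype_card, Fintype.card_subtype]
  have hA : Nat.card {i : Fin N // ¬ ∀ j : Fin N, dist (x i) (x j) ≤ 7 → K j} =
      (Finset.univ.filter fun i : Fin N => ¬ ∀ j : Fin N, dist (x i) (x j) ≤ 7 → K j).card := by
    rw [Nat.card_eq_fintype_card, Fintype.card_subtype]
  have hsub : (Finset.univ.filter fun i : Fin N => ¬ ∀ j : Fin N, dist (x i) (x j) ≤ 7 → K j) ⊆
      B.biUnion fun j => Finset.univ.filter fun i : Fin N => dist (x i) (x j) ≤ 7 := by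
    intro i hi
    simp only [Finset.mem_filter, Finset.mem_univ, true_and, not_forall, exists_prop] at hi
    obtain ⟨j, hj, hK⟩ := hi
    simp only [Finset.mem_biUnion, Finset.mem_filter, Finset.mem_univ, true_and, hB]
    exact ⟨j, hK, hj⟩
  rw [hA, hB']
  calc ((Finset.univ.filter fun i : Fin N => ¬ ∀ j : Fin N, dist (x i) (x j) ≤ 7 → K j).card : ℝ)
      ≤ (B.biUnion fun j => Finset.univ.filter fun i : Fin N => dist (x i) (x j) ≤ 7).card := by
        exact_mod_cast Finset.card_le_card hsub
    _ ≤ ∑ j ∈ B, ((Finset.univ.filter fun i : Fin N => dist (x i) (x j) ≤ 7).card : ℝ) := by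
        exact_mod_cast Finset.card_biUnion_le
    _ ≤ ∑ j ∈ B, (29 : ℝ) ^ 3 :=
        Finset.sum_le_sum fun j _ => card_filter_dist_le_seven_le x hsep j
    _ = 29 ^ 3 * B.card := by rw [Finset.sum_const, nsmul_eq_mul, mul_comm]

/-- Below the gap the soft neighbour relation does not depend on the tolerance: if
`d ≤ 1 + η ∨ 63/50 ≤ d` and `η ≤ η₁`, `1 + η₁ < 63/50`, then `d ≤ 1 + η₁ ↔ d ≤ 1 + η`. -/
theorem le_iff_le_of_gap {d η η₁ : ℝ} (hη : η ≤ η₁) (hη₁ : 1 + η₁ < 63 / 50)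
    (h : d ≤ 1 + η ∨ 63 / 50 ≤ d) : d ≤ 1 + η₁ ↔ d ≤ 1 + η :=
  ⟨fun hd => h.elim id fun h' => absurd (h'.trans hd) (not_le.2 hη₁), fun hd => hd.trans (by linarith)⟩

/-- Soft twelve-kissedness is monotone in the tolerance below the gap. -/
theorem kissed_mono {N : ℕ} (x : Fin N → EuclideanSpace ℝ (Fin 3)) {η η₁ : ℝ} (hη : η ≤ η₁)
    (hη₁ : 1 + η₁ < 63 / 50) (j : Fin N)
    (h : (∀ l : Fin N, l ≠ j → (1 - η) ≤ dist (x j) (x l) ∧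
        (dist (x j) (x l) ≤ (1 + η) ∨ 63 / 50 ≤ dist (x j) (x l))) ∧
      Nat.card {l : Fin N // l ≠ j ∧ dist (x j) (x l) ≤ (1 + η)} = 12) :
    (∀ l : Fin N, l ≠ j → (1 - η₁) ≤ dist (x j) (x l) ∧
        (dist (x j) (x l) ≤ (1 + η₁) ∨ 63 / 50 ≤ dist (x j) (x l))) ∧
      Nat.card {l : Fin N // l ≠ j ∧ dist (x j) (x l) ≤ (1 + η₁)} = 12 := by
  refine ⟨fun l hl => ⟨by linarith [(h.1 l hl).1], (h.1 l hl).2.imp_left fun h' => by linarith⟩,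
    ?_⟩
  rw [← h.2]
  exact Nat.card_congr (Equiv.subtypeEquivRight fun l =>
    ⟨fun hl => ⟨hl.1, (le_iff_le_of_gap hη hη₁ (h.1 l hl.1).2).1 hl.2⟩,
      fun hl => ⟨hl.1, hl.2.trans (by linarith)⟩⟩)

/-- In an injective configuration, soft kissedness of the particle `l` (indexed form) gives soft
kissedness of the point `x l` in the set `range x` (set form, as in `SoftLocalHales`). -/
theorem kissedSet_of_kissed {N : ℕ} (x : Fin N → EuclideanSpace ℝ (Fin 3))
    (hinj : Function.Injective x) (η : ℝ) (l : Fin N)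
    (h : (∀ m : Fin N, m ≠ l → (1 - η) ≤ dist (x l) (x m) ∧
        (dist (x l) (x m) ≤ (1 + η) ∨ 63 / 50 ≤ dist (x l) (x m))) ∧
      Nat.card {m : Fin N // m ≠ l ∧ dist (x l) (x m) ≤ (1 + η)} = 12) :
    (∀ w ∈ Set.range x, w ≠ x l → 1 - η ≤ dist (x l) w ∧
        (dist (x l) w ≤ 1 + η ∨ 63 / 50 ≤ dist (x l) w)) ∧
      {w ∈ Set.range x | w ≠ x l ∧ dist (x l) w ≤ 1 + η}.ncard = 12 := by
  refine ⟨?_, ?_⟩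
  · rintro w ⟨m, rfl⟩ hne
    exact h.1 m fun hml => hne (hml ▸ rfl)
  · have hset : {w ∈ Set.range x | w ≠ x l ∧ dist (x l) w ≤ 1 + η} =
        x '' {m : Fin N | m ≠ l ∧ dist (x l) (x m) ≤ 1 + η} := by
      ext w
      simp only [Set.mem_setOf_eq, Set.mem_image, Set.mem_range]
      constructor
      · rintro ⟨⟨m, rfl⟩, hne, hd⟩
        exact ⟨m, ⟨fun hml => hne (hml ▸ rfl), hd⟩, rfl⟩
      · rintro ⟨m, ⟨hne, hd⟩, rfl⟩
        exact ⟨⟨m, rfl⟩, fun h' => hne (hinj h'), hd⟩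
    rw [hset, Set.ncard_image_of_injective _ hinj, ← Nat.card_coe_set_eq, Set.coe_setOf]
    exact h.2

/-- Transport of a soft contact graph: from the set form at tolerance `η` (conclusion of
`SoftLocalHales` for `S = range x`, `u = x j`) to the indexed form at tolerance `η₁ ≥ η` (as in
the hypothesis of `BrittleBarlowRigidity`), below the gap. -/
theorem shell_transfer {N : ℕ} (x : Fin N → EuclideanSpace ℝ (Fin 3))
    (hinj : Function.Injective x)
    {η η₁ : ℝ} (hη : η ≤ η₁) (hη₁ : 1 + η₁ < 63 / 50) (j : Fin N)
    (hj : ∀ l : Fin N, l ≠ j → dist (x j) (x l) ≤ 1 + η ∨ 63 / 50 ≤ dist (x j) (x l))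
    (hk : ∀ k : Fin N, k ≠ j → dist (x j) (x k) ≤ 1 + η →
      ∀ l : Fin N, l ≠ k → dist (x k) (x l) ≤ 1 + η ∨ 63 / 50 ≤ dist (x k) (x l))
    (P : Finset (EuclideanSpace ℝ (Fin 3)))
    (h : ∃ e : {w : EuclideanSpace ℝ (Fin 3) //
          w ∈ Set.range x ∧ w ≠ x j ∧ dist (x j) w ≤ 1 + η} ≃ {q : EuclideanSpace ℝ (Fin 3) // q ∈ P},
      ∀ w w' : {w : EuclideanSpace ℝ (Fin 3) // w ∈ Set.range x ∧ w ≠ x j ∧ dist (x j) w ≤ 1 + η},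
        w ≠ w' → (dist w.1 w'.1 ≤ 1 + η ↔ dist (e w).1 (e w').1 = 1)) :
    ∃ e : {k : Fin N // k ≠ j ∧ dist (x j) (x k) ≤ (1 + η₁)} ≃
        {q : EuclideanSpace ℝ (Fin 3) // q ∈ P},
      ∀ k k' : {k : Fin N // k ≠ j ∧ dist (x j) (x k) ≤ (1 + η₁)},
        k ≠ k' → (dist (x k.1) (x k'.1) ≤ (1 + η₁) ↔ dist (e k).1 (e k').1 = 1) := by
  obtain ⟨e, he⟩ := h
  have hmapd : ∀ k : {k : Fin N // k ≠ j ∧ dist (x j) (x k) ≤ (1 + η₁)},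
      dist (x j) (x k.1) ≤ 1 + η :=
    fun k => (le_iff_le_of_gap hη hη₁ (hj k.1 k.2.1)).1 k.2.2
  let f : {k : Fin N // k ≠ j ∧ dist (x j) (x k) ≤ (1 + η₁)} →
      {w : EuclideanSpace ℝ (Fin 3) // w ∈ Set.range x ∧ w ≠ x j ∧ dist (x j) w ≤ 1 + η} :=
    fun k => ⟨x k.1, Set.mem_range_self _, fun h' => k.2.1 (hinj h'), hmapd k⟩
  have hf : Function.Bijective f := by
    constructor
    · intro k k' hkk'
      exact Subtype.ext (hinj (congrArg Subtype.val hkk'))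
    · rintro ⟨w, ⟨m, rfl⟩, hne, hd⟩
      exact ⟨⟨m, fun h' => hne (h' ▸ rfl), hd.trans (by linarith)⟩, rfl⟩
  refine ⟨(Equiv.ofBijective f hf).trans e, fun k k' hkk' => ?_⟩
  have hφ : Equiv.ofBijective f hf k ≠ Equiv.ofBijective f hf k' :=
    fun h' => hkk' ((Equiv.ofBijective f hf).injective h')
  have h1 := he _ _ hφ
  have h2 : dist (x k.1) (x k'.1) ≤ 1 + η₁ ↔ dist (x k.1) (x k'.1) ≤ 1 + η :=
    le_iff_le_of_gap hη hη₁
      (hk k.1 k.2.1 (hmapd k) k'.1 fun h' => hkk' (Subtype.ext h'.symm))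
  exact h2.trans h1

/-- The local step: if every atom within distance `7` of `x i` is softly twelve-kissed at
tolerance `η`, then every atom within distance `4` of `x i` is softly twelve-kissed at tolerance
`η₁ ∈ [η, 13/50)` and its soft contact graph at tolerance `η₁` is the fcc or the hcp pattern graph
(from `SoftLocalHales` at tolerance `η`, applied to `S = range x`). -/
theorem good_ball_of_kissed_ball {N : ℕ} (x : Fin N → EuclideanSpace ℝ (Fin 3))
    (hinj : Function.Injective x)
    {η η₁ : ℝ} (hη : η ≤ η₁) (hη₁ : 1 + η₁ < 63 / 50)
    (hSLH : ∀ (S : Set (EuclideanSpace ℝ (Fin 3))) (u : EuclideanSpace ℝ (Fin 3)), u ∈ S → (∀ v ∈ S, dist u v ≤ 1 + η → ((∀ w ∈ S, w ≠ v → 1 - η ≤ dist v w ∧ (dist v w ≤ 1 + η ∨ 63 / 50 ≤ dist v w)) ∧ {w ∈ S | w ≠ v ∧ dist v w ≤ 1 + η}.ncard = 12)) → ((∃ e : {w : EuclideanSpace ℝ (Fin 3) // w ∈ S ∧ w ≠ u ∧ dist u w ≤ 1 + η} ≃ {q : EuclideanSpace ℝ (Fin 3) // q ∈ Literature.Geometry.DiscreteGeometry.fccKissingPattern},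 ∀ w w' : {w : EuclideanSpace ℝ (Fin 3) // w ∈ S ∧ w ≠ u ∧ dist u w ≤ 1 + η}, w ≠ w' → (dist w.1 w'.1 ≤ 1 + η ↔ dist (e w).1 (e w').1 = 1)) ∨ (∃ e : {w : EuclideanSpace ℝ (Fin 3) // w ∈ S ∧ w ≠ u ∧ dist u w ≤ 1 + η} ≃ {q : EuclideanSpace ℝ (Fin 3) // q ∈ Literature.Geometry.DiscreteGeometry.hcpKissingPattern}, ∀ w w' : {w : EuclideanSpace ℝ (Fin 3) // w ∈ S ∧ w ≠ u ∧ dist u w ≤ 1 + η}, w ≠ w' → (dist w.1 w'.1 ≤ 1 + η ↔ dist (e w).1 (e w').1 = 1))))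
    (i : Fin N)
    (hgood : ∀ j : Fin N, dist (x i) (x j) ≤ 7 →
      (∀ l : Fin N, l ≠ j → (1 - η) ≤ dist (x j) (x l) ∧
          (dist (x j) (x l) ≤ (1 + η) ∨ 63 / 50 ≤ dist (x j) (x l))) ∧
        Nat.card {l : Fin N // l ≠ j ∧ dist (x j) (x l) ≤ (1 + η)} = 12) :
    ∀ j : Fin N, dist (x i) (x j) ≤ 4 → (((∀ l : Fin N, l ≠ j → (1 - η₁) ≤ dist (x j) (x l) ∧ (dist (x j) (x l) ≤ (1 + η₁) ∨ 63 / 50 ≤ dist (x j) (x l))) ∧ Nat.card {l : Fin N // l ≠ j ∧ dist (x j) (x l) ≤ (1 + η₁)} = 12) ∧ ((∃ e : {k : Fin N // k ≠ j ∧ dist (x j) (x k) ≤ (1 + η₁)} ≃ {q : EuclideanSpace ℝ (Fin 3) // q ∈ Literature.Geometry.DiscreteGeometry.fccKissingPattern}, ∀ k k' : {k : Fin N // k ≠ j ∧ dist (x j) (x k) ≤ (1 + η₁)}, k ≠ k' → (dist (x k.1) (x k'.1) ≤ (1 + η₁) ↔ dist (e k).1 (e k').1 = 1)) ∨ (∃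 e : {k : Fin N // k ≠ j ∧ dist (x j) (x k) ≤ (1 + η₁)} ≃ {q : EuclideanSpace ℝ (Fin 3) // q ∈ Literature.Geometry.DiscreteGeometry.hcpKissingPattern}, ∀ k k' : {k : Fin N // k ≠ j ∧ dist (x j) (x k) ≤ (1 + η₁)}, k ≠ k' → (dist (x k.1) (x k'.1) ≤ (1 + η₁) ↔ dist (e k).1 (e k').1 = 1)))) := by
  intro j hj
  have hη' : η < 13 / 50 := by linarith
  have hKj := hgood j (by linarith)
  refine ⟨kissed_mono x hη hη₁ j hKj, ?_⟩
  -- every atom within `1 + η` of `x j` is `η`-kissed (it lies within `7` of `x i`)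
  have hnb : ∀ k : Fin N, dist (x j) (x k) ≤ 1 + η →
      (∀ l : Fin N, l ≠ k → (1 - η) ≤ dist (x k) (x l) ∧
          (dist (x k) (x l) ≤ (1 + η) ∨ 63 / 50 ≤ dist (x k) (x l))) ∧
        Nat.card {l : Fin N // l ≠ k ∧ dist (x k) (x l) ≤ (1 + η)} = 12 := by
    intro k hk
    refine hgood k ?_
    have := dist_triangle (x i) (x j) (x k)
    linarith
  have hS := hSLH (Set.range x) (x j) (Set.mem_range_self j) (by
    rintro v ⟨l, rfl⟩ hd
    exact kissedSet_of_kissed x hinj η l (hnb l hd))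
  have hjd : ∀ l : Fin N, l ≠ j → dist (x j) (x l) ≤ 1 + η ∨ 63 / 50 ≤ dist (x j) (x l) :=
    fun l hl => (hKj.1 l hl).2
  have hkd : ∀ k : Fin N, k ≠ j → dist (x j) (x k) ≤ 1 + η →
      ∀ l : Fin N, l ≠ k → dist (x k) (x l) ≤ 1 + η ∨ 63 / 50 ≤ dist (x k) (x l) :=
    fun k _ hk l hl => ((hnb k hk).1 l hl).2
  exact hS.imp
    (shell_transfer x hinj hη hη₁ j hjd hkd Literature.Geometry.DiscreteGeometry.fccKissingPattern)
    (shell_transfer x hinj hη hη₁ j hjd hkd Literature.Geometry.DiscreteGeometry.hcpKissingPattern)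

/-- The per-`N` count: in a `1/2`-separated configuration, the atoms lacking a good `4`-ball at
tolerance `η₁` number at most `29³` times the atoms that are not softly twelve-kissed at
tolerance `η ≤ η₁` (given `SoftLocalHales` at tolerance `η`). -/
theorem card_bad_ball_le {N : ℕ} (x : Fin N → EuclideanSpace ℝ (Fin 3))
    (hsep : ∀ i j : Fin N, i ≠ j → (1 / 2 : ℝ) ≤ dist (x i) (x j))
    {η η₁ : ℝ} (hη : η ≤ η₁) (hη₁ : 1 + η₁ < 63 / 50)
    (hSLH : ∀ (S : Set (EuclideanSpace ℝ (Fin 3))) (u : EuclideanSpace ℝ (Fin 3)), u ∈ S → (∀ v ∈ S, dist u v ≤ 1 + η → ((∀ w ∈ S, w ≠ v → 1 - η ≤ dist v w ∧ (dist v w ≤ 1 + η ∨ 63 / 50 ≤ dist v w)) ∧ {w ∈ S | w ≠ v ∧ dist v w ≤ 1 + η}.ncard = 12)) → ((∃ e : {w : EuclideanSpace ℝ (Fin 3) // w ∈ S ∧ w ≠ u ∧ dist u w ≤ 1 + η} ≃ {q : EuclideanSpace ℝ (Fin 3) // q ∈ Literature.Geometry.DiscreteGeometry.fccKissingPattern},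 ∀ w w' : {w : EuclideanSpace ℝ (Fin 3) // w ∈ S ∧ w ≠ u ∧ dist u w ≤ 1 + η}, w ≠ w' → (dist w.1 w'.1 ≤ 1 + η ↔ dist (e w).1 (e w').1 = 1)) ∨ (∃ e : {w : EuclideanSpace ℝ (Fin 3) // w ∈ S ∧ w ≠ u ∧ dist u w ≤ 1 + η} ≃ {q : EuclideanSpace ℝ (Fin 3) // q ∈ Literature.Geometry.DiscreteGeometry.hcpKissingPattern}, ∀ w w' : {w : EuclideanSpace ℝ (Fin 3) // w ∈ S ∧ w ≠ u ∧ dist u w ≤ 1 + η}, w ≠ w' → (dist w.1 w'.1 ≤ 1 + η ↔ dist (e w).1 (e w').1 = 1)))) :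
    (Nat.card {i : Fin N // ¬ ∀ j : Fin N, dist (x i) (x j) ≤ 4 → (((∀ l : Fin N, l ≠ j → (1 - η₁) ≤ dist (x j) (x l) ∧ (dist (x j) (x l) ≤ (1 + η₁) ∨ 63 / 50 ≤ dist (x j) (x l))) ∧ Nat.card {l : Fin N // l ≠ j ∧ dist (x j) (x l) ≤ (1 + η₁)} = 12) ∧ ((∃ e : {k : Fin N // k ≠ j ∧ dist (x j) (x k) ≤ (1 + η₁)} ≃ {q : EuclideanSpace ℝ (Fin 3) // q ∈ Literature.Geometry.DiscreteGeometry.fccKissingPattern}, ∀ k k' : {k : Fin N // k ≠ j ∧ dist (x j) (x k) ≤ (1 + η₁)}, k ≠ k' → (dist (x k.1) (x k'.1) ≤ (1 + η₁) ↔ dist (e k).1 (e k').1 = 1)) ∨ (∃ e : {k : Fin N // k ≠ j ∧ dist (x j) (x k) ≤ (1 + η₁)} ≃ {q : EuclideanSpace ℝ (Fin 3) // q ∈ Literature.Geometry.DiscreteGeometry.hcpKissingPattern}, ∀ k k' : {k : Fin N // k ≠ j ∧ dist (x j) (x k) ≤ (1 + η₁)}, k ≠ k' → (dist (x k.1) (x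 k'.1) ≤ (1 + η₁) ↔ dist (e k).1 (e k').1 = 1))))} : ℝ) ≤
      29 ^ 3 * Nat.card {i : Fin N // ¬ ((∀ j : Fin N, j ≠ i → (1 - η) ≤ dist (x i) (x j) ∧ (dist (x i) (x j) ≤ (1 + η) ∨ 63 / 50 ≤ dist (x i) (x j))) ∧ Nat.card {j : Fin N // j ≠ i ∧ dist (x i) (x j) ≤ (1 + η)} = 12)} := by
  have hinj : Function.Injective x := fun i i' h => by
    by_contra hne
    have := hsep i i' hne
    rw [h, dist_self] at this
    norm_num at this
  refine le_trans ?_ (card_not_forall_ball_le x hsep fun j => (∀ l : Fin N, l ≠ j →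
      (1 - η) ≤ dist (x j) (x l) ∧ (dist (x j) (x l) ≤ (1 + η) ∨ 63 / 50 ≤ dist (x j) (x l))) ∧
    Nat.card {l : Fin N // l ≠ j ∧ dist (x j) (x l) ≤ (1 + η)} = 12)
  exact_mod_cast natCard_subtype_le_of_imp fun i =>
    mt (good_ball_of_kissed_ball x hinj hη hη₁ hSLH i)

end BrittleRungDescentRungAssembly

open BrittleRungDescentRungAssembly in
/-- **`RungAssembly`** (item `stmt-AtomisticToContinuum-10947`, route `BrittleRungDescent`):
`SoftLocalHales → LadderGroundStates → MieSoftKissing → BrittleBarlowRigidity → MieRung`.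
With `η := min η₀ η₁ ≤ 1/100` and `q ≥ max (max p₀ p₁) (max q₁ 4)`, `BrittleBarlowRigidity`
applies to `V_q`: ground states exist (`LadderGroundStates`), and along every ground-state
sequence the fraction of atoms without a good `4`-ball at tolerance `η₁` is at most `29³` times
the fraction of non-`η`-kissed atoms (`card_bad_ball_le`, separation `1 - 2/q ≥ 1/2`), which
tends to `0` by `MieSoftKissing`. -/
theorem brittleRungDescent_rungAssembly_proof :
    Summit.AtomisticToContinuum.Crystallization.Theses.BrittleRungDescent.RungAssembly := by
  unfold RungAssembly SoftLocalHales LadderGroundStates MieSoftKissing BrittleBarlowRigidity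
    MieRung
  intro hSLH hLGS hMSK hBBR
  obtain ⟨η₀, hη₀, hSLH⟩ := hSLH
  obtain ⟨q₁, hLGS⟩ := hLGS
  obtain ⟨η₁, hη₁, hη₁', p₁, hBBR⟩ := hBBR
  obtain ⟨p₀, hMSK⟩ := hMSK (min η₀ η₁) (lt_min hη₀ hη₁) ((min_le_right _ _).trans hη₁')
  refine ⟨max (max p₀ p₁) (max q₁ 4), fun q hq => ?_⟩
  have hp₀ : p₀ ≤ q := le_trans (le_trans (le_max_left _ _) (le_max_left _ _)) hq
  have hp₁ : p₁ ≤ q := le_trans (le_trans (le_max_right _ _) (le_max_left _ _)) hq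
  have hq₁ : q₁ ≤ q := le_trans (le_trans (le_max_left _ _) (le_max_right _ _)) hq
  have h4 : 4 ≤ q := le_trans (le_trans (le_max_right _ _) (le_max_right _ _)) hq
  obtain ⟨hex, hsep⟩ := hLGS q hq₁
  refine hBBR q hp₁ hex fun x hx => ?_
  have hK := hMSK q hp₀ x hx
  have hsep' : ∀ N, ∀ i j : Fin N, i ≠ j → (1 / 2 : ℝ) ≤ dist (x N i) (x N j) := by
    intro N i j hij
    have h := hsep N (x N) (hx N) i j hij
    have hq4 : (4 : ℝ) ≤ q := by exact_mod_cast h4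
    have hqpos : (0 : ℝ) < q := by linarith
    have h2q : 2 / (q : ℝ) ≤ 1 / 2 := by
      rw [div_le_iff₀ hqpos]
      linarith
    linarith
  refine tendsto_div_natCast_of_le_mul (C := 29 ^ 3) hK (fun N => Nat.cast_nonneg _) fun N => ?_
  exact card_bad_ball_le (x N) (hsep' N) (min_le_right η₀ η₁) (by linarith)
    (hSLH (min η₀ η₁) (lt_min hη₀ hη₁) (min_le_left _ _))

end Summit.AtomisticToContinuum.Crystallization.Theorems
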